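import Literature.Analysis.FluidPDE.TorusABCFlow
import Literature.Analysis.FluidPDE.SteadyNSLatticePersistence
import Summits.NavierStokesRegularity.FluidComputer.AbcLinearisedLattice

/-!
# Lattice symmetries of the ABC linearisation: signed-permutation actions commute with the
# linearised convective symbol and the Leray multiplier; the two generators of the flow's 24-group
(instab3 g4 — implementation 1 of the skew-cut X0 certifier, cell `ns-blowup`, 2026-08-26)

HONEST FRAMING (human ruling D-0035): nothing here is a claim about Navier–Stokes blow-up.
WHAT THIS IS NOT: not NS evidence. MODEL lane — CLASS RESTRICTION (P3) of the X0 chain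
(KERNEL-CHAIN.md (A5), HOME/instab4; INSTAB3-METHOD §1): the certified brackets are for the linearised
operator about the ABC flow RESTRICTED TO SYMMETRY CLASS II (the sign character of the flow's
24-element symmetry group `Γ ≅ O ≅ S₄`, Dombre et al. 1986), so the kernel needs «`L` commutes with `Γ`».
On the Fourier lattice a rigid symmetry `x ↦ Mx + t` of `T³` (`M` a signed permutation, `t ∈ (¼ℤ)³`)
acts on vector coefficient families by

  `(ρ c)(k) = θ(k) · M c(Mᵀ k)`,  `θ(k) = e^{−2πi k·t}` a character of `ℤ³`,

written here WITHOUT new definitions through the data `(π, σ, θ)`: `(M v)ₚ = σₚ v_{π p}`,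
`(Mᵀ k)ᵢ = σ_{π⁻¹ i} k_{π⁻¹ i}`, `θ(m) θ(k − m) = θ(k)`.

* §1 bookkeeping of `T = Mᵀ` on `ℤ³` (a bijection, additive, `|T k|² = |k|²`, `k·(Mv) = (Tk)·v`,
  `M (T k) = k`).
* §2 **equivariance of the convective symbol** (`transportSym_equivariant`): for ANY families `a, b`,
  `N(ρa, ρb)(k) = θ(k) M N(a, b)(Mᵀ k)` — no summability needed (signed permutations act by single
  entries; the lattice sum is re-indexed by the bijection `T`).
* §3 **equivariance of the Leray multiplier** (`lerayCoeff_equivariant`): `Π_k (M v) = M Π_{Mᵀk} v`.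
* §4 **equivariance of the linearised ABC symbol and of the whole lattice operator**
  `c ↦ ν·4π²|k|²c + Π[N(â,c) + N(c,â)]` under any `(π, σ, θ)` leaving the ABC coefficients invariant
  (`hinv : ρ â = â`): `linSym_abcFlow_equivariant`, `linOp_abcFlow_equivariant`, and CLASS INVARIANCE
  `linOp_abcFlow_class_invariant` — if `ρ c = χ c` then `ρ (L c) = χ (L c)`; with the two GENERATORS of
  `Γ` (sequel file `AbcLatticeSymmetryGenerators`: `r : x ↦ (x₁, x₂, x₀)`, `θ = 1`, `χ_II(r) = +1`;
  `s : x ↦ (x₀ + ¼, x₂ + ¾, −x₁ + ¼)`, `θ_s(k) = (−i)^{k₀+3k₁+k₂}`, `χ_II(s) = −1`; `⟨r, s⟩ = Γ`, found by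
  exact search) this is the class restriction P3: CLASS II `= {c : ρ_r c = c, ρ_s c = −c}` is
  `L`-invariant, in the tree's lattice vocabulary.

Mathlib + Literature + `AbcLinearisedLattice`; no definitions (the actions enter through characterising
hypotheses `hρ : ∀ m p, ρc m p = θ m * (σ p * c (T m) (π p))`).
-/

noncomputable section

open scoped BigOperators Topology InnerProductSpace ComplexConjugate
open Filter Set Function MeasureTheory UnitAddTorus Finset

namespace Summit.NavierStokesRegularity.FluidComputer.AbcLatticeSymmetry

open Literature.Analysis.FluidPDE Literature.Analysis.FluidPDE.SteadyLattice
open Literature.Analysis.FunctionSpaces Literature.Analysis.FunctionSpaces.Torus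
open Literature.Analysis.FunctionSpaces.EuclideanSpace
open Literature.Analysis.FluidPDE.ScalarFourier

/-! ### §1 The dual lattice map `T = Mᵀ` of a signed permutation -/

section Generic

variable (π : Equiv.Perm (Fin 3)) (σ : Fin 3 → ℤ)

/-- `T = Mᵀ : k ↦ (σ_{π⁻¹ i} k_{π⁻¹ i})ᵢ` is a bijection of `ℤ³` (an involution up to `π`), for signs
`σₚ² = 1`. -/
theorem latT_bijective (hσ : ∀ p, σ p * σ p = 1) :
    Function.Bijective (fun k : Fin 3 → ℤ => fun i : Fin 3 => σ (π.symm i) * k (π.symm i)) := by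
  refine ⟨fun k k' h => ?_, fun k' => ⟨fun j => σ j * k' (π j), ?_⟩⟩
  · funext j
    have hj := congrFun h (π j)
    simp only [Equiv.symm_apply_apply] at hj
    have := congrArg (fun z => σ j * z) hj
    simpa [← mul_assoc, hσ j] using this
  · funext i
    simp only [Equiv.apply_symm_apply, ← mul_assoc, hσ, one_mul]

/-- `T` is additive: `T (k − m) = T k − T m`. -/
theorem latT_sub (k m : Fin 3 → ℤ) :
    (fun i : Fin 3 => σ (π.symm i) * (k - m) (π.symm i)) =
      (fun i : Fin 3 => σ (π.symm i) * k (π.symm i)) - fun i : Fin 3 => σ (π.symm i) * m (π.symm i) := by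
  funext i
  simp only [Pi.sub_apply, mul_sub]

/-- `T` preserves the lattice norm: `|T k|² = |k|²`. -/
theorem freqNormSq_latT (hσ : ∀ p, σ p * σ p = 1) (k : Fin 3 → ℤ) :
    freqNormSq (fun i : Fin 3 => σ (π.symm i) * k (π.symm i)) = freqNormSq k := by
  unfold freqNormSq
  rw [← Equiv.sum_comp π.symm (fun j => ((k j : ℤ) : ℝ) ^ 2)]
  refine Finset.sum_congr rfl fun i _ => ?_
  have h : ((σ (π.symm i) : ℤ) : ℝ) ^ 2 = 1 := by exact_mod_cast (by rw [sq]; exact hσ _)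
  push_cast
  rw [mul_pow, h, one_mul]

/-- The pairing transforms by `k·(M v) = (T k)·v`. -/
theorem kdot_act (k : Fin 3 → ℤ) (v : EuclideanSpace ℂ (Fin 3)) :
    (∑ p : Fin 3, ((k p : ℤ) : ℂ) * ((σ p : ℂ) * v (π p))) =
      ∑ i : Fin 3, (((σ (π.symm i) * k (π.symm i) : ℤ)) : ℂ) * v i := by
  rw [← Equiv.sum_comp π (fun i => (((σ (π.symm i) * k (π.symm i) : ℤ)) : ℂ) * v i)]
  refine Finset.sum_congr rfl fun p _ => ?_
  simp only [Equiv.symm_apply_apply, Int.cast_mul]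
  ring

/-- `M (T k) = k`: the action on the frequency vector of `T k` returns `k`. -/
theorem act_freqVec_latT (hσ : ∀ p, σ p * σ p = 1) (k : Fin 3 → ℤ) (p : Fin 3) :
    (σ p : ℂ) * Torus.freqVec (fun i : Fin 3 => σ (π.symm i) * k (π.symm i)) (π p) = ((k p : ℤ) : ℂ) := by
  rw [Torus.freqVec_apply]
  simp only [Equiv.symm_apply_apply, Int.cast_mul]
  have h : ((σ p : ℤ) : ℂ) * ((σ p : ℤ) : ℂ) = 1 := by exact_mod_cast hσ p
  rw [← mul_assoc, h, one_mul]

/-! ### §2 Equivariance of the convective symbol under `(ρ c)(k) = θ(k) M c(T k)` -/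

/-- The signs move the derivative symbol to the transformed frequency:
`σⱼ · 2πi xⱼ = 2πi (T x)_{π j}`. -/
theorem sigma_mul_dsym (j : Fin 3) (x : Fin 3 → ℤ) :
    (σ j : ℂ) * dsym j x = dsym (π j) (fun i : Fin 3 => σ (π.symm i) * x (π.symm i)) := by
  rw [dsym_apply, dsym_apply]
  simp only [Equiv.symm_apply_apply, Int.cast_mul]
  ring

/-- **Equivariance of the transport symbol** under a signed-permutation symmetry with character `θ`:
if `(ρa)(m)ₚ = θ(m) σₚ a(Tm)_{πp}` and likewise for `b`, then for every `k` and component `p`,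
`N(ρa, ρb)(k)ₚ = θ(k) σₚ N(a, b)(T k)_{π p}` — for ARBITRARY families (no summability: the sum over
`m ∈ ℤ³` is re-indexed by the bijection `T`). -/
theorem transportSym_equivariant (hσ : ∀ p, σ p * σ p = 1) (θ : (Fin 3 → ℤ) → ℂ)
    (hθ : ∀ k m, θ m * θ (k - m) = θ k) (a b ρa ρb : (Fin 3 → ℤ) → EuclideanSpace ℂ (Fin 3))
    (hρa : ∀ m p, ρa m p = θ m * ((σ p : ℂ) * a (fun i : Fin 3 => σ (π.symm i) * m (π.symm i)) (π p)))
    (hρb : ∀ m p, ρb m p = θ m * ((σ p : ℂ) * b (fun i : Fin 3 => σ (π.symm i) * m (π.symm i)) (π p)))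
    (k : Fin 3 → ℤ) (p : Fin 3) :
    transportSym (fun jj mm => ρa mm jj) (fun mm => ρb mm p) k =
      θ k * ((σ p : ℂ) * transportSym (fun jj mm => a mm jj) (fun mm => b mm (π p))
        (fun i : Fin 3 => σ (π.symm i) * k (π.symm i))) := by
  set T : (Fin 3 → ℤ) → (Fin 3 → ℤ) := fun k => fun i : Fin 3 => σ (π.symm i) * k (π.symm i) with hT
  have hTsub : ∀ k m, T (k - m) = T k - T m := fun k m => latT_sub π σ k m
  set e : (Fin 3 → ℤ) ≃ (Fin 3 → ℤ) := Equiv.ofBijective T (latT_bijective π σ hσ) with he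
  rw [transportSym_apply, transportSym_apply]
  simp_rw [lconv_apply]
  -- componentwise identity inside the lattice sum
  have hpt : ∀ j m, ρa m j * (dsym j (k - m) * ρb (k - m) p) =
      θ k * (σ p : ℂ) * (a (T m) (π j) * (dsym (π j) (T k - T m) * b (T k - T m) (π p))) := by
    intro j m
    rw [hρa, hρb, ← hTsub, ← sigma_mul_dsym π σ j (k - m), ← hθ k m]
    ring
  simp_rw [hpt]
  -- pull out the constants and re-index the lattice sum by `T`
  have hre : ∀ j,
      ∑' m, θ k * (σ p : ℂ) * (a (T m) (π j) * (dsym (π j) (T k - T m) * b (T k - T m) (π p))) =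
        θ k * (σ p : ℂ) * ∑' m, a m (π j) * (dsym (π j) (T k - m) * b (T k - m) (π p)) := by
    intro j
    rw [tsum_mul_left]
    congr 1
    exact e.tsum_eq (fun m => a m (π j) * (dsym (π j) (T k - m) * b (T k - m) (π p)))
  simp_rw [hre]
  rw [← Finset.mul_sum, mul_assoc]
  congr 2
  exact Equiv.sum_comp π (fun i => ∑' m, a m i * (dsym i (T k - m) * b (T k - m) (π p)))

/-! ### §3 Equivariance of the Leray multiplier -/

/-- **`Π_k (M v) = M Π_{T k} v`** for a signed permutation `M` (`(Mv)ₚ = σₚ v_{πp}`, `T = Mᵀ`): the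
Leray multiplier commutes with lattice symmetries (`|Tk| = |k|`, `k·(Mv) = (Tk)·v`, `M(Tk) = k`). -/
theorem lerayCoeff_equivariant (hσ : ∀ p, σ p * σ p = 1) (k : Fin 3 → ℤ) (v : EuclideanSpace ℂ (Fin 3))
    (p : Fin 3) :
    Torus.lerayCoeff k (WithLp.toLp 2 fun q : Fin 3 => (σ q : ℂ) * v (π q)) p =
      (σ p : ℂ) * Torus.lerayCoeff (fun i : Fin 3 => σ (π.symm i) * k (π.symm i)) v (π p) := by
  have h0 : (fun i : Fin 3 => σ (π.symm i) * (0 : Fin 3 → ℤ) (π.symm i)) = 0 := by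
    funext i; simp
  by_cases hk : k = 0
  · subst hk
    rw [h0, Torus.lerayCoeff_zero, Torus.lerayCoeff_zero]
    simp
  · have hTk : (fun i : Fin 3 => σ (π.symm i) * k (π.symm i)) ≠ 0 := fun h =>
      hk ((latT_bijective π σ hσ).1 (h.trans h0.symm))
    have h2 := act_freqVec_latT π σ hσ k p
    rw [Torus.lerayCoeff_of_ne_zero hk, Torus.lerayCoeff_of_ne_zero hTk, Torus.leraySym_def,
      Torus.leraySym_def, freqNormSq_latT π σ hσ k]
    simp only [PiLp.sub_apply, PiLp.smul_apply, smul_eq_mul, Torus.freqVec_apply k p]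
    rw [kdot_act π σ k v, ← h2]
    ring

/-! ### §4 Equivariance of the linearised ABC symbol and of the whole lattice operator (generic form) -/

/-- **Equivariance of the linearised convective symbol about the ABC flow** under a lattice symmetry
`(π, σ, θ)` that leaves the ABC coefficients invariant (`hinv : ρ â = â`): for any family `c` and its
transform `ρc`, `M(ρc)(k)ₚ = θ(k) σₚ M(c)(T k)_{πp}`, `M(c) = N(â, c) + N(c, â)`. -/
theorem linSym_abcFlow_equivariant (hσ : ∀ p, σ p * σ p = 1) (θ : (Fin 3 → ℤ) → ℂ)
    (hθ : ∀ k m, θ m * θ (k - m) = θ k) (A B C : ℝ)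
    (hinv : ∀ m p, (mFourierCoeff (complexify ∘ Torus.abcFlow A B C)) m p = θ m * ((σ p : ℂ) *
      (mFourierCoeff (complexify ∘ Torus.abcFlow A B C)) (fun i : Fin 3 => σ (π.symm i) * m (π.symm i)) (π p)))
    (c ρc : (Fin 3 → ℤ) → EuclideanSpace ℂ (Fin 3))
    (hρc : ∀ m p, ρc m p = θ m * ((σ p : ℂ) * c (fun i : Fin 3 => σ (π.symm i) * m (π.symm i)) (π p)))
    (k : Fin 3 → ℤ) (p : Fin 3) :
    ((WithLp.toLp 2 (fun pp : Fin 3 => transportSym (fun jj mm => (mFourierCoeff (complexify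
        ∘ Torus.abcFlow A B C)) mm jj) (fun mm => ρc mm pp) k) : EuclideanSpace ℂ (Fin 3)) +
      (WithLp.toLp 2 (fun pp : Fin 3 => transportSym (fun jj mm => ρc mm jj) (fun mm => (mFourierCoeff
        (complexify ∘ Torus.abcFlow A B C)) mm pp) k) : EuclideanSpace ℂ (Fin 3))) p =
      θ k * ((σ p : ℂ) * ((WithLp.toLp 2 (fun pp : Fin 3 => transportSym (fun jj mm => (mFourierCoeff
        (complexify ∘ Torus.abcFlow A B C)) mm jj) (fun mm => c mm pp) (fun i : Fin 3 => σ (π.symm i) *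
        k (π.symm i))) : EuclideanSpace ℂ (Fin 3)) +
      (WithLp.toLp 2 (fun pp : Fin 3 => transportSym (fun jj mm => c mm jj) (fun mm => (mFourierCoeff
        (complexify ∘ Torus.abcFlow A B C)) mm pp) (fun i : Fin 3 => σ (π.symm i) * k (π.symm i))) :
        EuclideanSpace ℂ (Fin 3))) (π p)) := by
  rw [PiLp.add_apply, PiLp.toLp_apply, PiLp.toLp_apply, PiLp.add_apply, PiLp.toLp_apply, PiLp.toLp_apply,
    transportSym_equivariant π σ hσ θ hθ _ c _ ρc hinv hρc k p,
    transportSym_equivariant π σ hσ θ hθ c _ ρc _ hρc hinv k p]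
  ring

/-- **Equivariance of the whole linearised lattice operator**
`(L c)(k) = ν·4π²|k|² c(k) + Π_k [N(â, c)(k) + N(c, â)(k)]` about the ABC flow under a symmetry that
leaves `â` invariant: `L(ρc)(k)ₚ = θ(k) σₚ L(c)(T k)_{πp}` (`|Tk| = |k|`, `Π_k M = M Π_{Tk}`). -/
theorem linOp_abcFlow_equivariant (hσ : ∀ p, σ p * σ p = 1) (θ : (Fin 3 → ℤ) → ℂ)
    (hθ : ∀ k m, θ m * θ (k - m) = θ k) (A B C ν : ℝ)
    (hinv : ∀ m p, (mFourierCoeff (complexify ∘ Torus.abcFlow A B C)) m p = θ m * ((σ p : ℂ) *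
      (mFourierCoeff (complexify ∘ Torus.abcFlow A B C)) (fun i : Fin 3 => σ (π.symm i) * m (π.symm i)) (π p)))
    (c ρc : (Fin 3 → ℤ) → EuclideanSpace ℂ (Fin 3))
    (hρc : ∀ m p, ρc m p = θ m * ((σ p : ℂ) * c (fun i : Fin 3 => σ (π.symm i) * m (π.symm i)) (π p)))
    (k : Fin 3 → ℤ) (p : Fin 3) :
    ((((ν * (4 * Real.pi ^ 2 * freqNormSq k)) : ℝ) : ℂ) • ρc k +
      Torus.lerayCoeff k ((WithLp.toLp 2 (fun pp : Fin 3 => transportSym (fun jj mm => (mFourierCoeff (complexify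
        ∘ Torus.abcFlow A B C)) mm jj) (fun mm => ρc mm pp) k) : EuclideanSpace ℂ (Fin 3)) +
      (WithLp.toLp 2 (fun pp : Fin 3 => transportSym (fun jj mm => ρc mm jj) (fun mm => (mFourierCoeff
        (complexify ∘ Torus.abcFlow A B C)) mm pp) k) : EuclideanSpace ℂ (Fin 3)))) p =
      θ k * ((σ p : ℂ) * ((((ν * (4 * Real.pi ^ 2 * freqNormSq (fun i : Fin 3 => σ (π.symm i) *
        k (π.symm i)))) : ℝ) : ℂ) • c (fun i : Fin 3 => σ (π.symm i) * k (π.symm i)) +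
      Torus.lerayCoeff (fun i : Fin 3 => σ (π.symm i) * k (π.symm i)) ((WithLp.toLp 2 (fun pp : Fin 3 =>
        transportSym (fun jj mm => (mFourierCoeff (complexify ∘ Torus.abcFlow A B C)) mm jj) (fun mm => c mm pp)
        (fun i : Fin 3 => σ (π.symm i) * k (π.symm i))) : EuclideanSpace ℂ (Fin 3)) +
      (WithLp.toLp 2 (fun pp : Fin 3 => transportSym (fun jj mm => c mm jj) (fun mm => (mFourierCoeff
        (complexify ∘ Torus.abcFlow A B C)) mm pp) (fun i : Fin 3 => σ (π.symm i) * k (π.symm i))) :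
        EuclideanSpace ℂ (Fin 3)))) (π p)) := by
  -- the symbol transforms as a vector: `M(ρc)(k) = θ k • act (M(c)(T k))`
  have hvec : ((WithLp.toLp 2 (fun pp : Fin 3 => transportSym (fun jj mm => (mFourierCoeff (complexify
        ∘ Torus.abcFlow A B C)) mm jj) (fun mm => ρc mm pp) k) : EuclideanSpace ℂ (Fin 3)) +
      (WithLp.toLp 2 (fun pp : Fin 3 => transportSym (fun jj mm => ρc mm jj) (fun mm => (mFourierCoeff
        (complexify ∘ Torus.abcFlow A B C)) mm pp) k) : EuclideanSpace ℂ (Fin 3))) =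
      θ k • WithLp.toLp 2 (fun q : Fin 3 => (σ q : ℂ) * ((WithLp.toLp 2 (fun pp : Fin 3 =>
        transportSym (fun jj mm => (mFourierCoeff (complexify ∘ Torus.abcFlow A B C)) mm jj) (fun mm => c mm pp)
        (fun i : Fin 3 => σ (π.symm i) * k (π.symm i))) : EuclideanSpace ℂ (Fin 3)) +
      (WithLp.toLp 2 (fun pp : Fin 3 => transportSym (fun jj mm => c mm jj) (fun mm => (mFourierCoeff
        (complexify ∘ Torus.abcFlow A B C)) mm pp) (fun i : Fin 3 => σ (π.symm i) * k (π.symm i))) :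
        EuclideanSpace ℂ (Fin 3))) (π q)) := by
    ext q
    rw [linSym_abcFlow_equivariant π σ hσ θ hθ A B C hinv c ρc hρc k q, PiLp.smul_apply, PiLp.toLp_apply,
      smul_eq_mul]
  rw [PiLp.add_apply, PiLp.smul_apply, hvec, lerayCoeff_smul', PiLp.smul_apply,
    lerayCoeff_equivariant π σ hσ k _ p, freqNormSq_latT π σ hσ k, hρc k p, smul_eq_mul, smul_eq_mul,
    PiLp.add_apply, PiLp.smul_apply, smul_eq_mul]
  ring

/-- **Class invariance.** If `c` lies in the `χ`-eigenspace of the symmetry (`ρ c = χ c`, e.g. `χ = −1`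
for the sign character on the generator `s`: the class-II condition), then so does `L c`:
`θ(k) σₚ (L c)(T k)_{πp} = χ (L c)(k)ₚ`. -/
theorem linOp_abcFlow_class_invariant (hσ : ∀ p, σ p * σ p = 1) (θ : (Fin 3 → ℤ) → ℂ)
    (hθ : ∀ k m, θ m * θ (k - m) = θ k) (A B C ν : ℝ)
    (hinv : ∀ m p, (mFourierCoeff (complexify ∘ Torus.abcFlow A B C)) m p = θ m * ((σ p : ℂ) *
      (mFourierCoeff (complexify ∘ Torus.abcFlow A B C)) (fun i : Fin 3 => σ (π.symm i) * m (π.symm i)) (π p)))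
    (χ : ℂ) (c : (Fin 3 → ℤ) → EuclideanSpace ℂ (Fin 3))
    (hc : ∀ m p, θ m * ((σ p : ℂ) * c (fun i : Fin 3 => σ (π.symm i) * m (π.symm i)) (π p)) = χ * c m p)
    (k : Fin 3 → ℤ) (p : Fin 3) :
    θ k * ((σ p : ℂ) * ((((ν * (4 * Real.pi ^ 2 * freqNormSq (fun i : Fin 3 => σ (π.symm i) *
        k (π.symm i)))) : ℝ) : ℂ) • c (fun i : Fin 3 => σ (π.symm i) * k (π.symm i)) +
      Torus.lerayCoeff (fun i : Fin 3 => σ (π.symm i) * k (π.symm i)) ((WithLp.toLp 2 (fun pp : Fin 3 =>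
        transportSym (fun jj mm => (mFourierCoeff (complexify ∘ Torus.abcFlow A B C)) mm jj) (fun mm => c mm pp)
        (fun i : Fin 3 => σ (π.symm i) * k (π.symm i))) : EuclideanSpace ℂ (Fin 3)) +
      (WithLp.toLp 2 (fun pp : Fin 3 => transportSym (fun jj mm => c mm jj) (fun mm => (mFourierCoeff
        (complexify ∘ Torus.abcFlow A B C)) mm pp) (fun i : Fin 3 => σ (π.symm i) * k (π.symm i))) :
        EuclideanSpace ℂ (Fin 3)))) (π p)) =
      χ * ((((ν * (4 * Real.pi ^ 2 * freqNormSq k)) : ℝ) : ℂ) • c k +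
      Torus.lerayCoeff k ((WithLp.toLp 2 (fun pp : Fin 3 => transportSym (fun jj mm => (mFourierCoeff (complexify
        ∘ Torus.abcFlow A B C)) mm jj) (fun mm => c mm pp) k) : EuclideanSpace ℂ (Fin 3)) +
      (WithLp.toLp 2 (fun pp : Fin 3 => transportSym (fun jj mm => c mm jj) (fun mm => (mFourierCoeff
        (complexify ∘ Torus.abcFlow A B C)) mm pp) k) : EuclideanSpace ℂ (Fin 3)))) p := by
  -- `ρc := χ • c` is the transform of `c`
  have h := linOp_abcFlow_equivariant π σ hσ θ hθ A B C ν hinv c (fun m => χ • c m)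
    (fun m q => by rw [PiLp.smul_apply, smul_eq_mul, hc m q]) k p
  rw [← h]
  -- linearity of the lattice operator in `c`
  have hN1 : (WithLp.toLp 2 (fun pp : Fin 3 => transportSym (fun jj mm => (mFourierCoeff (complexify
        ∘ Torus.abcFlow A B C)) mm jj) (fun mm => (χ • c mm) pp) k) : EuclideanSpace ℂ (Fin 3)) =
      χ • (WithLp.toLp 2 (fun pp : Fin 3 => transportSym (fun jj mm => (mFourierCoeff (complexify
        ∘ Torus.abcFlow A B C)) mm jj) (fun mm => c mm pp) k) : EuclideanSpace ℂ (Fin 3)) := by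
    exact nl_smul_right χ (mFourierCoeff (complexify ∘ Torus.abcFlow A B C)) c k
  have hN2 : (WithLp.toLp 2 (fun pp : Fin 3 => transportSym (fun jj mm => (χ • c mm) jj) (fun mm => (mFourierCoeff
        (complexify ∘ Torus.abcFlow A B C)) mm pp) k) : EuclideanSpace ℂ (Fin 3)) =
      χ • (WithLp.toLp 2 (fun pp : Fin 3 => transportSym (fun jj mm => c mm jj) (fun mm => (mFourierCoeff
        (complexify ∘ Torus.abcFlow A B C)) mm pp) k) : EuclideanSpace ℂ (Fin 3)) := by
    exact nl_smul_left χ c (mFourierCoeff (complexify ∘ Torus.abcFlow A B C)) k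
  rw [hN1, hN2, ← smul_add, lerayCoeff_smul', PiLp.add_apply, PiLp.add_apply, PiLp.smul_apply, PiLp.smul_apply,
    PiLp.smul_apply, PiLp.smul_apply, smul_eq_mul, smul_eq_mul, smul_eq_mul, smul_eq_mul]
  ring

end Generic

end Summit.NavierStokesRegularity.FluidComputer.AbcLatticeSymmetry

end
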